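import Mathlib
import Summits.CriticalPhenomena.PercolationContinuityZ3.Theorems.PercNearOneGluingNoHeavyLowerTailOddsBernstein
import HarnessLib

/-!
# THEOREM X in discrete form: `x_m = 1 − e_{m−1}/e_m = γQ(m)/((γ+m)P(m))` is completely monotone (`γ ≥ 1 − θ₀`)

Support file for the Sahi / Conjecture-P programme of route `PercNearOneGluingNoHeavy`
(`--supports stmt-CriticalPhenomena-4575`, prover prim-l12-p5 gen 37; proof note
`prim-l12-p5/PROOF-ODDS-BERNSTEIN-g37.md` §2).  No definitions, no named facts, no sorries.

g36 (PROOF-THEOREM-H-g36 §6′) proved THEOREM X — the sequence `x_m := 1 − e_{m−1}/e_m`,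
`e_m = [z^m](1−hz)^θ(1−z)^{−(θ+γ+1)}`, equivalently `x_m = γ·₂F₁(−θ,−m;γ;g)/((γ+m)·₂F₁(−θ,−m;γ+1;g))`, is completely
monotone — analytically (Laplace representation on `(−γ−1,∞)`), and used it for THEOREM N⁺⁺ (`q_A ≥ 1`).  With
THEOREM A′ of `…LowerTailOddsBernstein` the discrete statement becomes a kernel one-liner in Region I (`γ ≥ 1−θ₀`):
by **c-contiguity** (`hyp_c_contig`: `c(H a c (r+1) − H a (c+1) (r+1)) = (r+1)(H a (c+1) (r+1) − H a (c+1) r)`, i.e.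
`γQ(m) = (γ+m)P(m) − mP(m−1)`) one has `x = 1/(1+a)` with `a` the pure-grabber odds, a positive sequence with completely
monotone first difference, so LEMMA DB (`altSum_inv_nonneg`) applies: `pureGrabber_x_altSum_nonneg`.
-/

namespace Summit.CriticalPhenomena.PercolationContinuityZ3.Theorems

namespace HypergeomCM

open Finset MomentRatioTN
open scoped Nat

section

variable (g : ℝ) (H : ℝ → ℝ → ℕ → ℝ)
  (hH : ∀ a c r, H a c r = ∑ k ∈ range (r + 1), (r.choose k : ℝ) * (-g) ^ k *
    ((∏ i ∈ range k, (a + i)) / (∏ i ∈ range k, (c + i))))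
include hH

/-- **c-contiguity** (`γQ(m) = (γ+m)P(m) − mP(m−1)` in the memo's notation):
`c·(H a c (r+1) - H a (c+1) (r+1)) = (r+1)·(H a (c+1) (r+1) - H a (c+1) r)`  (termwise:
`c(1/(c)_k - 1/(c+1)_k) = k/(c+1)_k` and `(r+1)(C(r+1,k) - C(r,k)) = k C(r+1,k)`). -/
theorem hyp_c_contig (a c : ℝ) (hc : 0 < c) (r : ℕ) :
    c * (H a c (r + 1) - H a (c + 1) (r + 1)) = ((r : ℝ) + 1) * (H a (c + 1) (r + 1) - H a (c + 1) r) := by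
  have hr : H a (c + 1) r = ∑ k ∈ range (r + 1 + 1), (r.choose k : ℝ) * (-g) ^ k *
      ((∏ i ∈ range k, (a + i)) / (∏ i ∈ range k, (c + 1 + i))) := by
    rw [hH a (c + 1) r, sum_range_succ _ (r + 1), Nat.choose_eq_zero_of_lt (Nat.lt_succ_self r)]
    simp
  rw [hH a c (r + 1), hH a (c + 1) (r + 1), hr, ← sum_sub_distrib, ← sum_sub_distrib, mul_sum, mul_sum]
  refine sum_congr rfl fun k _ => ?_
  have e1 : ((r : ℝ) + 1) * (((r + 1).choose k : ℝ) - (r.choose k : ℝ)) = (k : ℝ) * ((r + 1).choose k : ℝ) := by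
    rcases k with _ | k
    · simp
    · have h1 : (r + 1).choose (k + 1) = r.choose k + r.choose (k + 1) := Nat.choose_succ_succ' r k
      have h2 : (r + 1) * r.choose k = (r + 1).choose (k + 1) * (k + 1) := Nat.add_one_mul_choose_eq r k
      have h1' : (((r + 1).choose (k + 1) : ℕ) : ℝ) = (r.choose k : ℝ) + (r.choose (k + 1) : ℝ) := by
        exact_mod_cast h1
      have h2' : ((r : ℝ) + 1) * (r.choose k : ℝ) = (((r + 1).choose (k + 1) : ℕ) : ℝ) * ((k : ℝ) + 1) := by
        exact_mod_cast h2
      push_cast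
      linear_combination ((r : ℝ) + 1) * h1' + h2'
  -- c · ∏_{i<k}(c+1+i) = (∏_{i<k}(c+i)) · (c+k)
  have e2 : c * ∏ i ∈ range k, (c + 1 + (i : ℝ)) = (∏ i ∈ range k, (c + (i : ℝ))) * (c + k) := by
    rw [← prod_succ_shift c k, prod_range_succ]
  have hPc : (∏ i ∈ range k, (c + (i : ℝ))) ≠ 0 := (prod_pos_of_pos c hc k).ne'
  have hPc1 : (∏ i ∈ range k, (c + 1 + (i : ℝ))) ≠ 0 := (prod_pos_of_pos (c + 1) (by linarith) k).ne'
  have hck : (c + (k : ℝ)) ≠ 0 := by positivity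
  -- 1/∏(c+i) = (c+k)/(c ∏(c+1+i))
  have q : ((∏ i ∈ range k, (c + (i : ℝ))))⁻¹ = (c + k) * (c * ∏ i ∈ range k, (c + 1 + (i : ℝ)))⁻¹ := by
    rw [e2, mul_inv, ← mul_assoc, mul_comm (c + (k : ℝ)), mul_assoc, mul_inv_cancel₀ hck, mul_one]
  rw [div_eq_mul_inv, div_eq_mul_inv, q, mul_inv]
  field_simp
  linear_combination -((-g) ^ k * (∏ i ∈ range k, (a + (i : ℝ)))) * e1

/-- **THEOREM X (discrete form) for `γ ≥ 1 − θ₀`** (g36 §6′ proved it analytically for all `γ > 0`).  Let `θ = θ₀ + n`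
(`0 < θ₀ ≤ 1`), `γ > 0`, `γ ≥ 1 - θ₀`, `0 ≤ g < 1`.  Then
`x_m := γ Q_θ(m)/((γ+m) P(m)) = 1 − m P(m−1)/((γ+m) P(m)) = 1 − e_{m−1}/e_m`
(`P = ₂F₁(-θ,-·;γ+1;g)`, `Q_θ = ₂F₁(-θ,-·;γ;g)`) is a completely monotone sequence: by c-contiguity
`x = 1/(1 + a)` with `a` the (discrete Bernstein, THEOREM A′) pure-grabber odds, and LEMMA DB. -/
theorem pureGrabber_x_altSum_nonneg (hg0 : 0 ≤ g) (hg1 : g < 1) (θ₀ : ℝ) (h0 : 0 < θ₀) (h1 : θ₀ ≤ 1)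
    (n : ℕ) (γ : ℝ) (hγ : 0 < γ) (hγ1 : 1 - θ₀ ≤ γ) (k j : ℕ) :
    0 ≤ ∑ i ∈ range (k + 1), (-1 : ℝ) ^ i * (k.choose i : ℝ) *
      (γ * H (-(θ₀ + n)) γ (j + i) / ((γ + ((j + i : ℕ) : ℝ)) * H (-(θ₀ + n)) (γ + 1) (j + i))) := by
  have hθ : 0 ≤ θ₀ + n := by positivity
  have hQ : ∀ m, 0 < H (-(θ₀ + n)) γ m := fun m => hyp_pos g H hH hg0 hg1 (-(θ₀ + n)) m γ hγ (by linarith)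
  have hP : ∀ m, 0 < H (-(θ₀ + n)) (γ + 1) m :=
    fun m => hyp_pos g H hH hg0 hg1 (-(θ₀ + n)) m (γ + 1) (by linarith) (by linarith)
  -- f m := 1 + a_m = (γ+m) P(m)/(γ Q(m))  (c-contiguity), positive with CM first difference
  set f : ℕ → ℝ := fun m => (γ + (m : ℝ)) * H (-(θ₀ + n)) (γ + 1) m / (γ * H (-(θ₀ + n)) γ m) with hfdef
  have hfpos : ∀ m, 0 < f m := fun m => by
    simp only [hfdef]
    exact div_pos (mul_pos (by positivity) (hP m)) (mul_pos hγ (hQ m))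
  have hfa : ∀ m : ℕ, f m = 1 + (m : ℝ) * H (-(θ₀ + n)) (γ + 1) (m - 1) / (γ * H (-(θ₀ + n)) γ m) := by
    intro m
    simp only [hfdef]
    have hQ0 := (hQ m).ne'
    have hγ0 := hγ.ne'
    rcases m with _ | r
    · rw [hyp_zero g H hH, hyp_zero g H hH]; simp [hγ0]
    · have hc := hyp_c_contig g H hH (-(θ₀ + n)) γ hγ r
      rw [Nat.add_sub_cancel]
      push_cast
      field_simp
      linear_combination -hc
  have hΔ : ∀ k j, 0 ≤ ∑ i ∈ range (k + 1), (-1 : ℝ) ^ i * (k.choose i : ℝ) * (f (j + i + 1) - f (j + i)) := by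
    intro k j
    have := pureGrabber_oddsDiff_altSum_nonneg g H hH hg0 hg1 θ₀ h0 h1 n γ hγ hγ1 k j
    refine le_of_le_of_eq this (sum_congr rfl fun i _ => ?_)
    rw [hfa (j + i + 1), hfa (j + i)]
    push_cast
    ring_nf
  have hinv := altSum_inv_nonneg f hfpos hΔ k j
  refine le_of_le_of_eq hinv (sum_congr rfl fun i _ => ?_)
  simp only [hfdef]
  have hQ0 := (hQ (j + i)).ne'
  have hP0 := (hP (j + i)).ne'
  have hγ0 := hγ.ne'
  have : (γ + ((j + i : ℕ) : ℝ)) ≠ 0 := by positivity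
  push_cast
  field_simp

end

end HypergeomCM

end Summit.CriticalPhenomena.PercolationContinuityZ3.Theorems
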